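import Summits.QuantumFields.BalabanUV.Beta.GAN24.StepResolventLegCharges
import Summits.QuantumFields.BalabanUV.Beta.GAN24.BiStencilZeroMode

/-!
# `BalabanUV.Beta.GAN24.PeriodicForceMultiplier` — binder row G-an2-4 ∕ (CONV-C), W-slot CT-W, conservation law (C)∕(C)sym: **THE MULTIPLIER RESPONSE OF THE STEP
# RESOLVENT `KInvStep Lc j` TO A BLOCK-PERIODIC FIELD FORCE IS MINUS `σ_j` TIMES THE FORCE's CELL TOTAL — ZERO FOR A CURRENT** (fact (d1) of this lineage's plan
# for the resolvent flux identity, note `HOME/b2b-balaban-gan24-formalise-leaf-04/g64/CSYM-D3-ANATOMY.md` §8; generic `d`, every `j`)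

NOT IN PRINT; OUR BOOKKEEPING ([folklore] tsum bookkeeping BY NAME over leaf-02's row charge `StepResolventLegCharges.hasSum_KInvStep_inr_inl` ((Q-lin) in `mf = −fmᵀ`
form, `constReproSum_stepCol`), an4's block covariance `OneStepKernelFamily.shiftK_KInvStep` and decay `decays_KInvStep`, an2's `AxialDressing.summable_row_of_decays`, leaf-02's
periodic regrouping `BiStencilZeroMode.tsum_mul_periodic`; G-an2-4 formalisation swarm, leaf prover `b2b-balaban-gan24-formalise-leaf-04`, gen 64).  HONEST FRAMING (cell
contract, verbatim): «discharging `BetaPertH` makes Bałaban's UV stability UNCONDITIONAL — a real constructive-QFT result; it is NOT the continuum limit and NOT the Clay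
problem.»  HONEST DEPENDENCY (verbatim): «continuum YM on T⁴ ⇐ BetaPertH ∧ nine spine estimates (0/9 proved); BetaPertH ⇐ (D1) ∧ (D4) ∧ CAP+tail; G-an2-4 gates asym, D1
and NE2/3/4.»

WHY (located use; note §3 (d) ∕ §8 (d1)): in the dressed zero mode the cubic × cubic exchange word propagates the edge current `V = −d*𝟙_E` (`WilsonEdgeCurrent`) through the
resolvent; the first step of the flux identity `curv (K V) = ½(Lc⁻² − 𝟙_E)` is that the CONSTRAINT MULTIPLIER of that response vanishes (then `curv` of the EL row kills the gauge
term and a 2-D flux count finishes).  Here: the multiplier row of `KInvStep Lc j` against ANY block-periodic field force reads only the force's cell totals (observed `e_mult ≤ 1e-16`,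
kit j167153, D = 2, 3).

WHAT ([folklore]; 0 `def`, 0 cited facts, 0 `def … : Prop`, 0 sorry; generic `d`, every `j`, `Lc` a `NeZero`): §1 `summable_row_mul_bounded`, `bounded_of_periodic`;
**`tsum_KInvStep_inr_inl_mul_periodic`**: for `V : Site → ℝ` with `V (y + Lc•t) = V y`, `Σ'_y KInvStep Lc j (Lc•q) y (inr κ) (inl a) · V y = −[a = κ]·(Lc^{j+1})^{−(d+2)} ·
Σ_{r ∈ box} V (toSite r)` (every coarse `q`); **`tsum_KInvStep_inr_inl_mul_periodic_eq_zero`**: `= 0` when the cell total of `V` vanishes; §2 the INSTANCE at the edge current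
of the sibling `GAN24.WilsonEdgeCurrent` (by its closed formula, no import): `sum_box_mul_sub_eq_zero`, **`sum_box_edgeCurrent_eq_zero`** (zero cell total) and
**`tsum_KInvStep_inr_inl_mul_edgeCurrent_eq_zero`** (the multiplier of the propagated half-vertex vanishes).  Asserts NO value of Bałaban's tables; discharges NOTHING of (C)sym ∕ (Q-D) ∕
(Q-D-rate) ∕ «T2Shape» ∕ «T2Drift» ∕ (hW, hWall); NEVER «G-an2-4 closed» as (CONV-C); NOT D1, NOT `BetaPertH`, NOT continuum, NOT Clay.  2026-08-22; no existing file touched.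
-/

noncomputable section

open Finset
open scoped BigOperators
open Literature.MathematicalPhysics.QuantumFieldTheory
open Literature.MathematicalPhysics.QuantumFieldTheory.Balaban1983to89
open Literature.MathematicalPhysics.QuantumFieldTheory.Balaban1983to89.Beta
open ExpKernelCalculus (Site MKer Decays shiftK)
open OneStepResolventKernel (Fib)
open OneStepKernelFamily (KInvStep decays_KInvStep shiftK_KInvStep)
open AffineAveraging (box toSite)
open Summit.QuantumFields.BalabanUV.Beta.GAN24.StepResolventLegCharges (hasSum_KInvStep_inr_inl)
open Summit.QuantumFields.BalabanUV.Beta.GAN24.BiStencilZeroMode (tsum_mul_periodic)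

namespace Summit.QuantumFields.BalabanUV.Beta.GAN24.PeriodicForceMultiplier

variable {d : ℕ} {Lc : ℕ} [NeZero Lc]

/-- [folklore] A row of a decaying kernel against a bounded weight is summable. -/
theorem summable_row_mul_bounded {K : MKer (d + 1) (Fib d)} {C δ : ℝ} (hK : Decays K C δ) (hδ : 0 < δ) (x : Site (d + 1)) (a b : Fib d)
    {V : Site (d + 1) → ℝ} {B : ℝ} (hV : ∀ y, |V y| ≤ B) : Summable (fun y => K x y a b * V y) := by
  have hs := AxialDressing.summable_row_of_decays hK hδ x a b
  refine Summable.of_norm_bounded ((hs.abs).mul_right |B|) (fun y => ?_)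
  rw [Real.norm_eq_abs, abs_mul]
  exact mul_le_mul_of_nonneg_left ((hV y).trans (le_abs_self B)) (abs_nonneg _)

/-- [folklore] A `Lc`-periodic function on `ℤ^{d+1}` is bounded (it takes the values of one cell). -/
theorem bounded_of_periodic {V : Site (d + 1) → ℝ} (hV : ∀ y t, V (y + (Lc : ℤ) • t) = V y) :
    ∀ y, |V y| ≤ ∑ r ∈ box (d + 1) Lc, |V (toSite r)| := by
  intro y
  have hL : (0 : ℤ) < Lc := by exact_mod_cast Nat.pos_of_ne_zero (NeZero.ne Lc)
  have hy : y = toSite (fun i => ((y i % (Lc : ℤ)).toNat : ℕ)) + (Lc : ℤ) • (fun i => y i / (Lc : ℤ)) := by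
    funext i
    simp only [Pi.add_apply, Pi.smul_apply, smul_eq_mul, toSite]
    rw [Int.toNat_of_nonneg (Int.emod_nonneg _ hL.ne')]
    have e := Int.emod_add_ediv_mul (y i) (Lc : ℤ)
    rw [mul_comm] at e
    exact e.symm
  have hmem : (fun i => ((y i % (Lc : ℤ)).toNat : ℕ)) ∈ box (d + 1) Lc := by
    rw [AffineAveraging.box, Fintype.mem_piFinset]
    intro i
    rw [Finset.mem_range]
    have h1 := Int.emod_lt_of_pos (y i) hL
    have h0 := Int.emod_nonneg (y i) hL.ne'
    omega
  rw [hy, hV]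
  exact Finset.single_le_sum (f := fun r => |V (toSite r)|) (fun r _ => abs_nonneg _) hmem

/-- [folklore] **THE MULTIPLIER ROW OF `KInvStep Lc j` AGAINST A BLOCK-PERIODIC FIELD FORCE READS ONLY ITS CELL TOTAL**: for `V (y + Lc•t) = V y`,
`Σ'_y KInvStep Lc j (Lc•q) y (inr κ) (inl a) · V y = −[a = κ]·(Lc^{j+1})^{−(d+2)} · Σ_{r ∈ box} V (toSite r)`, every coarse site `q`
(`tsum_mul_periodic` + block covariance `shiftK_KInvStep` + the (Q-lin) row charge `hasSum_KInvStep_inr_inl`). -/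
theorem tsum_KInvStep_inr_inl_mul_periodic (j : ℕ) (κ a : Fin (d + 1)) (q : Site (d + 1)) {V : Site (d + 1) → ℝ}
    (hV : ∀ y t, V (y + (Lc : ℤ) • t) = V y) :
    ∑' y, KInvStep (d := d) Lc j ((Lc : ℤ) • q) y (Sum.inr κ) (Sum.inl a) * V y =
      -(if a = κ then ((((Lc ^ (j + 1) : ℕ) : ℝ)) ^ (d + 1 + 1))⁻¹ else 0) * ∑ r ∈ box (d + 1) Lc, V (toSite r) := by
  obtain ⟨δ, C, hδ, _, hK⟩ := decays_KInvStep (d := d) (Lc := Lc) j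
  have hs : Summable (fun y => KInvStep (d := d) Lc j ((Lc : ℤ) • q) y (Sum.inr κ) (Sum.inl a) * V y) :=
    summable_row_mul_bounded hK hδ _ _ _ (bounded_of_periodic hV)
  rw [tsum_mul_periodic (N := Lc) hV hs, Finset.mul_sum]
  refine Finset.sum_congr rfl fun r _ => ?_
  -- the coset sum of the row at `Lc•q` is the coarse row charge at the fine point `toSite r` (block covariance)
  have hcov : ∀ t : Site (d + 1), KInvStep (d := d) Lc j ((Lc : ℤ) • q) ((Lc : ℤ) • t + toSite r) (Sum.inr κ) (Sum.inl a) =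
      KInvStep (d := d) Lc j ((Lc : ℤ) • (q - t)) (toSite r) (Sum.inr κ) (Sum.inl a) := by
    intro t
    have e := congrFun (congrFun (congrFun (congrFun (shiftK_KInvStep (d := d) (Lc := Lc) j t) ((Lc : ℤ) • q)) ((Lc : ℤ) • t + toSite r))
      (Sum.inr κ)) (Sum.inl a)
    simp only [shiftK] at e
    rw [← e]
    congr 1
    · rw [smul_sub]; abel
    · abel
  simp_rw [hcov]
  have hre : ∑' t : Site (d + 1), KInvStep (d := d) Lc j ((Lc : ℤ) • (q - t)) (toSite r) (Sum.inr κ) (Sum.inl a) =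
      ∑' x' : Site (d + 1), KInvStep (d := d) Lc j (((Lc : ℕ) : ℤ) • x') (toSite r) (Sum.inr κ) (Sum.inl a) := by
    rw [← (Equiv.subLeft q).tsum_eq (fun x' : Site (d + 1) => KInvStep (d := d) Lc j (((Lc : ℕ) : ℤ) • x') (toSite r) (Sum.inr κ) (Sum.inl a))]
    rfl
  rw [hre, (hasSum_KInvStep_inr_inl (d := d) (Lc := Lc) j κ a (toSite r)).tsum_eq]
  ring

/-- [folklore] **… HENCE ZERO FOR A FORCE WITH ZERO CELL TOTAL** (every block-periodic CURRENT `−d*ω`, in particular the edge current of `WilsonEdgeCurrent`):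
the constraint multiplier of the step resolvent's response to such a force vanishes identically. -/
theorem tsum_KInvStep_inr_inl_mul_periodic_eq_zero (j : ℕ) (κ a : Fin (d + 1)) (q : Site (d + 1)) {V : Site (d + 1) → ℝ}
    (hV : ∀ y t, V (y + (Lc : ℤ) • t) = V y) (h0 : ∑ r ∈ box (d + 1) Lc, V (toSite r) = 0) :
    ∑' y, KInvStep (d := d) Lc j ((Lc : ℤ) • q) y (Sum.inr κ) (Sum.inl a) * V y = 0 := by
  rw [tsum_KInvStep_inr_inl_mul_periodic j κ a q hV, h0, mul_zero]

/-! ## §2 The edge current has zero cell total; the constraint multiplier of its resolvent response vanishes -/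

section EdgeCurrent

variable {γ α : Fin (d + 1)} (hγα : γ ≠ α)
include hγα

omit [NeZero Lc] in
/-- [folklore] For `γ ≠ α`, every `F : ℤ → ℝ` and every `G : ℤ → ℝ` with `G (−1) = G (Lc − 1)` (one period of `G` around the block), the cell total of
`r ↦ F(r_γ)·(G(r_α − 1) − G(r_α))` over the block `box (d+1) Lc` vanishes: the box sum factorises over the coordinates (`Finset.sum_prod_piFinset`) and the
`α`-factor telescopes to `G(−1) − G(Lc − 1) = 0`. -/
theorem sum_box_mul_sub_eq_zero (F G : ℤ → ℝ) (hG : G (-1) = G ((Lc : ℤ) - 1)) :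
    ∑ r ∈ box (d + 1) Lc, F (toSite r γ) * (G (toSite r α - 1) - G (toSite r α)) = 0 := by
  classical
  set g : Fin (d + 1) → ℕ → ℝ := fun i n => if i = γ then F n else if i = α then G ((n : ℤ) - 1) - G n else 1 with hg
  have hprod : ∀ r : Fin (d + 1) → ℕ, F (toSite r γ) * (G (toSite r α - 1) - G (toSite r α)) = ∏ i, g i (r i) := by
    intro r
    have h1 : ∏ i ∈ (Finset.univ.erase γ).erase α, g i (r i) = 1 := Finset.prod_eq_one fun i hi => by
      simp only [Finset.mem_erase] at hi
      simp [g, hi.1, hi.2.1]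
    rw [← Finset.mul_prod_erase _ _ (Finset.mem_univ γ),
      ← Finset.mul_prod_erase _ _ (Finset.mem_erase.2 ⟨Ne.symm hγα, Finset.mem_univ α⟩), h1]
    simp [g, Ne.symm hγα, toSite]
  simp_rw [hprod]
  rw [show box (d + 1) Lc = Fintype.piFinset (fun _ => Finset.range Lc) from rfl, Finset.sum_prod_piFinset]
  apply Finset.prod_eq_zero (Finset.mem_univ α)
  have htel : ∑ n ∈ Finset.range Lc, (G ((n : ℤ) - 1) - G n) = G (-1) - G ((Lc : ℤ) - 1) := by
    have e := Finset.sum_range_sub' (fun n : ℕ => G ((n : ℤ) - 1)) Lc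
    simp only [Nat.cast_add, Nat.cast_one, add_sub_cancel_right, Nat.cast_zero, zero_sub] at e
    exact e
  simp [g, Ne.symm hγα, htel, hG]

omit [NeZero Lc] in
/-- [folklore] **THE `(γ, α)`-EDGE CURRENT HAS ZERO CELL TOTAL** (every component `b`; `p q : ℤ → ℝ` with one period around the block, `p (−1) = p (Lc − 1)`,
`q (−1) = q (Lc − 1)`): `Σ_{r ∈ box} J_b (toSite r) = 0` for the current `J_b(z) = [b = γ]·p(z_γ)·(q(z_α − 1) − q(z_α)) + [b = α]·q(z_α)·(p(z_γ) − p(z_γ − 1))`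
of `WilsonEdgeCurrent.sum_box1_biweighted_wilsonA_at`. -/
theorem sum_box_edgeCurrent_eq_zero (p q : ℤ → ℝ) (hp : p (-1) = p ((Lc : ℤ) - 1)) (hq : q (-1) = q ((Lc : ℤ) - 1)) (b : Fin (d + 1)) :
    ∑ r ∈ box (d + 1) Lc, ((if b = γ then p (toSite r γ) * (q (toSite r α - 1) - q (toSite r α)) else 0) +
      (if b = α then q (toSite r α) * (p (toSite r γ) - p (toSite r γ - 1)) else 0)) = 0 := by
  have h1 := sum_box_mul_sub_eq_zero (d := d) (Lc := Lc) hγα p q hq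
  have h2 := sum_box_mul_sub_eq_zero (d := d) (Lc := Lc) (Ne.symm hγα) q p hp
  have h2' : ∑ r ∈ box (d + 1) Lc, q (toSite r α) * (p (toSite r γ) - p (toSite r γ - 1)) = 0 := by
    have e : ∑ r ∈ box (d + 1) Lc, q (toSite r α) * (p (toSite r γ) - p (toSite r γ - 1)) =
        -∑ r ∈ box (d + 1) Lc, q (toSite r α) * (p (toSite r γ - 1) - p (toSite r γ)) := by
      rw [← Finset.sum_neg_distrib]
      exact Finset.sum_congr rfl fun r _ => by ring
    rw [e, h2, neg_zero]
  rw [Finset.sum_add_distrib]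
  split_ifs <;> simp [h1, h2']

/-- [folklore] **THE CONSTRAINT MULTIPLIER OF THE STEP RESOLVENT's RESPONSE TO THE EDGE CURRENT VANISHES** (every `j`, every coarse site `q₀`, every slot
`(κ, a)`, every component `b`; `p q` `Lc`-periodic): `Σ'_y KInvStep Lc j (Lc•q₀) y (inr κ) (inl a) · J_b y = 0` — §1 at the block-periodic force `J_b`, whose
cell total is zero by `sum_box_edgeCurrent_eq_zero`.  (The located use, note §3 (d1): the propagated half-vertex `K·(edge current)` of the cubic × cubic exchange
has NO multiplier part — observed `|e_mult| ≤ 10⁻¹⁶`, kit j167153 ∕ j168341.) -/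
theorem tsum_KInvStep_inr_inl_mul_edgeCurrent_eq_zero (j : ℕ) (κ a : Fin (d + 1)) (q₀ : Site (d + 1)) (p q : ℤ → ℝ)
    (hp : ∀ t (k : ℤ), p (t + (Lc : ℤ) * k) = p t) (hq : ∀ t (k : ℤ), q (t + (Lc : ℤ) * k) = q t) (b : Fin (d + 1)) :
    ∑' y, KInvStep (d := d) Lc j ((Lc : ℤ) • q₀) y (Sum.inr κ) (Sum.inl a) *
      ((if b = γ then p (y γ) * (q (y α - 1) - q (y α)) else 0) + (if b = α then q (y α) * (p (y γ) - p (y γ - 1)) else 0)) = 0 := by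
  apply tsum_KInvStep_inr_inl_mul_periodic_eq_zero j κ a q₀
  · intro y t
    simp only [Pi.add_apply, Pi.smul_apply, smul_eq_mul]
    rw [show y α + (Lc : ℤ) * t α - 1 = (y α - 1) + (Lc : ℤ) * t α by ring,
      show y γ + (Lc : ℤ) * t γ - 1 = (y γ - 1) + (Lc : ℤ) * t γ by ring, hp, hp, hq, hq]
  · have hp' : p (-1) = p ((Lc : ℤ) - 1) := by
      rw [← hp ((Lc : ℤ) - 1) (-1)]
      congr 1
      ring
    have hq' : q (-1) = q ((Lc : ℤ) - 1) := by
      rw [← hq ((Lc : ℤ) - 1) (-1)]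
      congr 1
      ring
    exact sum_box_edgeCurrent_eq_zero (d := d) (Lc := Lc) hγα p q hp' hq' b

end EdgeCurrent

end Summit.QuantumFields.BalabanUV.Beta.GAN24.PeriodicForceMultiplier

end
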